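import Mathlib
import Literature.Computability.AlgebraicComplexity.NestFreeMatchingPoly
import HarnessLib

/-!
# Route FifoMatching — crux `NNDivisionHard` (stmt-ValiantsHypothesis-21181): the SPLIT FACES of the nest-free matching
# polynomial — definitions

Objects of the «split face / prefix–suffix transport» step of the residual programme of stmt-21181 (module docstring of
`…NNDivisionHardLinearTransport`: every certificate `(h, NN_n · h)` restricts along a face `top_w NN_n = ι(NN_a) · S` at
additive cost).  For block sizes `b, c` (ambient `[0, 2(b+c))`, left block `L = [0, 2b)`, right block `R = [2b, 2(b+c))`):

* `lWeight b c` — the LEFT-INTERNAL DIRECTION `𝟙_L`: weight `1` on the arc variables `(i, j)` with both ends in `L`;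
* `shiftR b c : Fin (2c) → Fin (2(b+c))`, `j ↦ 2b + j`, and `blockEmbR b c = shiftR × shiftR` — the right block embedding
  of arc variables (the left one is `StackPowersQueue.blockEmb`);
* `restrictR b c M` — restriction of a self-map of `[0, 2(b+c))` to the right block in the local coordinate `j = p − 2b`
  (value clamped by truncated subtraction; meaningful on block-stable maps);
* `glue2 NL NR` — the TWO-SIDED GLUING: `NL` on `L`, `NR` (shifted) on `R`.

The lemmas (`…NNDivisionHardSplitFace`: `top_{𝟙_L}(NN_{b+c}) = ι_L(NN_b) · ι_R(NN_c)`, prefix and suffix transport)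
carry the hypotheses.  HONEST FRAMING: definitions only; nothing here bears on the crux, on `NNNotVP` or on VP ≠ VNP.
References: Chen–Deng–Du–Stanley–Yan 2007 §1 [ChenDengDuStanleyYan2007].
-/

noncomputable section

-- Sub = Summit single-conjunct layout: the duplicated namespace component is mandated by the tree.
set_option linter.dupNamespace false
set_option autoImplicit false

namespace Summit.ValiantsHypothesis.ValiantsHypothesis.Theorems.FifoMatching.NNDivisionHard.SplitFace

variable {b c : ℕ}

/-- The LEFT-INTERNAL DIRECTION `𝟙_L` on the arc variables of `[0, 2(b+c))`: `1` on `(i, j)` with `i, j < 2b`, else `0`.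
[folklore] -/
def lWeight (b c : ℕ) (e : Fin (2 * (b + c)) × Fin (2 * (b + c))) : ℕ :=
  if (e.1 : ℕ) < 2 * b ∧ (e.2 : ℕ) < 2 * b then 1 else 0

/-- The RIGHT SHIFT `j ↦ 2b + j` from `[0, 2c)` onto the right block `[2b, 2(b+c))`. [folklore] -/
def shiftR (b c : ℕ) (j : Fin (2 * c)) : Fin (2 * (b + c)) :=
  ⟨2 * b + (j : ℕ), by have := j.isLt; omega⟩

/-- The RIGHT BLOCK EMBEDDING of arc variables `(i, j) ↦ (2b+i, 2b+j)`. [folklore] -/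
def blockEmbR (b c : ℕ) : Fin (2 * c) × Fin (2 * c) → Fin (2 * (b + c)) × Fin (2 * (b + c)) :=
  Prod.map (shiftR b c) (shiftR b c)

/-- Restriction of a self-map of `[0, 2(b+c))` to the right block, in the local coordinate `j = p − 2b` (truncated
subtraction; meaningful on maps stabilising the blocks). [folklore] -/
def restrictR (b c : ℕ) (M : Fin (2 * (b + c)) → Fin (2 * (b + c))) (j : Fin (2 * c)) : Fin (2 * c) :=
  ⟨(M (shiftR b c j) : ℕ) - 2 * b, by have := (M (shiftR b c j)).isLt; have := j.isLt; omega⟩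

/-- TWO-SIDED GLUING: the self-map of `[0, 2(b+c))` that is `NL` on the left block `[0, 2b)` and `NR`, shifted by
`2b`, on the right block. [folklore] -/
def glue2 (NL : Fin (2 * b) → Fin (2 * b)) (NR : Fin (2 * c) → Fin (2 * c)) (i : Fin (2 * (b + c))) :
    Fin (2 * (b + c)) :=
  if h : (i : ℕ) < 2 * b then Fin.castLE (by omega) (NL ⟨i, h⟩)
  else shiftR b c (NR ⟨(i : ℕ) - 2 * b, by have := i.isLt; omega⟩)

end Summit.ValiantsHypothesis.ValiantsHypothesis.Theorems.FifoMatching.NNDivisionHard.SplitFace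

end
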